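import Summits.ResolutionOfSingularities.ResolutionOfSingularities.Theses.FoliationDescent
import Summits.ResolutionOfSingularities.ResolutionOfSingularities.Theses.ShadowGame
import Summits.ResolutionOfSingularities.ResolutionOfSingularities.Theses.Valuative
import Literature.AlgebraicGeometry.Resolution.ResolutionLU
import Summits.ResolutionOfSingularities.ResolutionOfSingularities.Theorems.DualSandwich.Negative.LoadBearing
import Summits.ResolutionOfSingularities.ResolutionOfSingularities.Theorems.DualSandwich.Negative.NaiveDescent
import HarnessLib

/-!
# Disproof of `DualSandwich` (stmt-ResolutionOfSingularities-17083) — findings: NO KILL POSSIBLE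
# short of a counterexample to resolution in characteristic `p`; every mutation and every stub of
# line `birth` is sandwiched between the crux and the summit; the ONE genuine falsity nearby is
# NAIVE DESCENT (the trace `B ∩ F` of the regular top is singular: `A₁` point) — LANDED, §5

Standing disprover: gen 1 (cdisprove-…-17083-0, cycle 1, §§0–4, landed
`Theorems/DualSandwich/Negative/LoadBearing.lean` p156457) and gen 2
(cdisprove-…-17083-g2-0, cycle 1, §5, landed `Theorems/DualSandwich/Negative/NaiveDescentSetup.lean`
p163817 and `…/NaiveDescent.lean`), route `ResolutionOfSingularities/FoliationDescent`,
crux #4 (rank 4, difficulty M, "consumed reduction"):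

  `DualSandwich := FolLU → LogCanQuotLU → TorsorLUPerfect`.

Every `theorem` below is kernel-checked (no `sorry`; axioms ⊆ {propext, Classical.choice,
Quot.sound}). Read with `Cruxes/DualSandwich/ATTACK-refuter.md` (crux-attack, one cycle,
verdict SURVIVES) and `Cruxes/DualSandwich/StubRelStepProof.lean` (the load-bearing stub
`stub_relStep : FolLU → LogCanQuotLU → RelStep p` PROVED) — not repeated here.

## Findings

* §0 IDENTITIES. `dualSandwich_iff` (definitional); `torsorLUPerfect_iff_shadowGame`: the
  consequent is byte-identical to ShadowGame's target stmt-16158 (`Iff.rfl`);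
  `torsorLUPerfect_of_luAlphaPTorsor`: it is Valuative's `LuAlphaPTorsor` (stmt-0641) restricted
  to perfect ground fields.
* §1 WEB (S → C). `luAlphaPTorsor_of_resolutionOfSingularities`,
  `torsorLUPerfect_of_resolutionOfSingularities` (resolution in char `p` ⇒ relative LU, tree
  `ResolutionInChar.relLocalUniformization`, applied to the model `k[A₀, t]`; `t ∈ O` because
  `t ^ p ∈ A₀ ⊆ O`), hence `dualSandwich_of_resolutionOfSingularities` and the contrapositive
  `not_resolutionOfSingularities_of_not_dualSandwich`: **an unconditional `¬ DualSandwich` is a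
  counterexample to resolution of singularities in positive characteristic.** Logically
  (`not_dualSandwich_iff`) a kill needs `FolLU ∧ LogCanQuotLU ∧ ¬ TorsorLUPerfect`: PROOFS of the
  two open cruxes (FolLU is graded open-problem) AND a refutation of LU of `α_p`-torsors over a
  perfect field (open in dim ≥ 4, no counterexample known or conjectured).
* §2 LOAD-BEARING ANALYSIS, as far as it can be pushed: the mutations `WithoutFolLU`
  (`LogCanQuotLU → TorsorLUPerfect`), `WithoutLogCanQuotLU` (`FolLU → TorsorLUPerfect`),
  `WithoutHypotheses` (`TorsorLUPerfect` itself) and `WithoutPerfect` (perfectness dropped from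
  the consequent: `FolLU → LogCanQuotLU → LuAlphaPTorsor`) each IMPLY the crux and each FOLLOW
  from the summit (`…_of_resolutionOfSingularities`), so NO `dualSandwich_false_without_<H>`
  theorem exists unless resolution fails: the hypotheses are load-bearing for the MECHANISM
  (the sandwich consumes `FolLU`/`LogCanQuotLU` exactly once per degree-`p` descent, at
  `D = d/dy`; perfectness makes the Frobenius top `A₀^{1/p}` finitely generated), not for the
  truth value. Recorded as `not_resolutionOfSingularities_of_not_without…`.
* §3 THE STUBS OF LINE `birth` ARE SUMMIT-IMPLIED TOO (verbatim copies of `FrobeniusTop`,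
  `RelStep`, `RelChain` from `Lines/birth.lean`, sha 6dc986c0…): `frobeniusTop_of_torsorLUPerfect`
  (take `L := K`, `O' := O`, `B :=` the uniformizing model — so `FrobeniusTop` carries no risk of
  falsity; its CONTENT is only that the intended witness `L = K₀^{1/p}`, `B = A₀^{1/p}` avoids
  this circularity), `relStep_of_relChain` (degree `p` is a finite purely inseparable extension),
  and `relChain_of_resolutionInChar` (§3b: `RelChain p` is relative LU of `O ∩ K ∋ R` for the
  field `K/k`, which is finitely generated because `K ⊆ L = Frac B` with `[L : K] < ∞` —
  `fg_top_of_fg_top_of_isPurelyInseparable`, proved here — so `Res_p` gives it through the tree's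
  `lurel_of_resolutionInChar`). `stubs_of_resolutionOfSingularities` bundles the three stub
  STATEMENTS as consequences of the summit: no stub of the picked line can be killed by a
  counterexample either; the line's only risk is formalization cost (Frobenius-twisted
  `K`-algebra structure on `K₀`, induction on `[L : K]`), exactly as the vet (BC3-VET.md) says.
* §4 DEGENERATE INSTANCES exercised on paper (ATTACK-refuter.md §3) and here for the trivial
  valuation: nothing bites; `t ∈ K₀`, `O = K`, `trdeg ≤ 1`, codimension-one centres are all
  consistent with the typing.
* §5 (gen 2) NATURAL STRENGTHENING REFUTED — NAIVE DESCENT IS FALSE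
  (`Theorems.naiveDescent_false`, landed under `Theorems/DualSandwich/Negative/NaiveDescent.lean`,
  re-exported here as `naiveDescent_false`): in the exact situation of the descent step `RelStep`
  (`k = 𝔽₂` perfect, `F ⊆ L` with `L² ⊆ F` and `L = F(y)`, `B = 𝔽₂[X₀,X₁]` a finitely generated
  model of `L = 𝔽₂(X₀,X₁)` regular at the centre of the order valuation `O`), the TRACE
  `C = B ∩ F` — for `F = ker (X₀∂₀ + X₁∂₁) = 𝔽₂(X₀², X₀X₁)` it is `𝔽₂[X₀², X₀X₁, X₁²]`, the
  `A₁` / `μ₂`-quotient point — is NOT regular at the centre (`u = X₀² ∈ 𝔪 ∖ 𝔪²` by orders, so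
  Matsumura 14.2/14.3 would make `(u)` prime in `C_𝔮`, but `w = X₀X₁` has `w² = u·X₁² ∈ (u)`,
  `w ∉ (u)`). CONSEQUENCES FOR THE LINE: (i) `stub_relStep` cannot be bookkeeping — the regular
  model of the bottom field is not the trace of the regular top, a modification is consumed at
  EVERY degree-`p` step (in the route: `FolLU` refines the top, `LogCanQuotLU` uniformizes the
  constants; the proved `StubRelStepProof.lean` does exactly this); (ii) in `stub_relChain` the
  transport `A := B.comap _` is available only in the base case `K = L`; (iii) dually, the same
  ring is the multiplicative-case tightness example of `LogCanQuotLU` (`A := S' ∩ K^D` fails for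
  `D = X₀∂₀ + X₁∂₁`, `D^[2] = D`), now certified in Lean. Also recorded (§5, one-liners): the crux
  closes VACUOUSLY if either sibling crux is refuted (`dualSandwich_of_not_folLU`,
  `dualSandwich_of_not_logCanQuotLU`), and `dualSandwich_iff_and`.
* `-- Targets`: none this cycle (payload `targets = []`, `stuck_stubs = []`, lead cycles 0; line
  `birth` registered, `stub_relStep` already proved by the crux-attack refuter).

## Why it resists (for the provers)

`DualSandwich` is glue whose consequent is (a restriction of) local uniformization; it is
PROVABLE NOW along line `birth` (`DualSandwich_of` kernel-checked; `stub_relStep` proved by the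
crux-attack refuter; `FrobeniusTop`, `RelChain` true by elementary field/valuation bookkeeping)
and UN-REFUTABLE by anything short of `¬ Res_p`. The disprover therefore has no target in this
crux; if the lead gets stuck, the stuck goal will be bookkeeping (transport of
`IsRegularLocalRing (Localization.AtPrime …)` along equal valuation subrings / Frobenius), not a
false statement — ask for `disprover-wanted:` only with a concrete stub signature.

LEAN LESSON from §5 (for whoever proves `stub_frobeniusTop` / `stub_relChain`): never manipulate
`R := Localization.AtPrime 𝔮` with generic hom-class lemmas (`map_mul`, `Ideal.map_span`) or
build `R ⧸ I` by hand — instance-path defeq checks on `OreLocalization` time out at 200k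
heartbeats; do the algebra over an ABSTRACT `R` with `[IsLocalization.AtPrime R 𝔮]` and
specialise once (`NaiveDescentSetup.exists_mul_eq_mul_of_isRegularLocalRing` is the pattern), and
transport regularity only through `IsRegularLocalRing.of_ringEquiv` /
`isRegularLocalRing_localization_atPrime_congr`.
-/

set_option linter.dupNamespace false

noncomputable section

open Summit.ResolutionOfSingularities.ResolutionOfSingularities.Theses
open Summit.ResolutionOfSingularities.ResolutionOfSingularities.Theses.FoliationDescent
  (FolLU LogCanQuotLU TorsorLUPerfect DualSandwich)
open Literature.AlgebraicGeometry.Resolution (ResolutionInChar isFractionRing_of_le)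

namespace Summit.ResolutionOfSingularities.ResolutionOfSingularities.Cruxes.DualSandwich.Disproof

/-! ## §0 Identities -/

/-- The crux is, definitionally, the implication between the route's three other items. -/
theorem dualSandwich_iff : DualSandwich ↔ (FolLU → LogCanQuotLU → TorsorLUPerfect) := Iff.rfl

/-- The consequent `TorsorLUPerfect` is byte-identical to ShadowGame's target (stmt-16158). -/
theorem torsorLUPerfect_iff_shadowGame : TorsorLUPerfect ↔ ShadowGame.TorsorLUPerfect := Iff.rfl

/-- `TorsorLUPerfect` is Valuative's `LuAlphaPTorsor` (stmt-0641, all ground fields) restricted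
to perfect ground fields: the perfectness instance is simply discarded. -/
theorem torsorLUPerfect_of_luAlphaPTorsor (h : Valuative.LuAlphaPTorsor) : TorsorLUPerfect :=
  fun p hp k K _ _ _ _ _ O A₀ h₀ t => h p hp k K O A₀ h₀ t

/-! ## Helpers (as in `Cruxes/Steer/Disproof.lean`, kept local to this work file) -/

section Helpers

variable {k K : Type} [Field k] [Field K] [Algebra k K]

/-- Valuation rings are integrally closed, in the only form needed: `t ^ n ∈ O ⇒ t ∈ O`. -/
theorem mem_of_pow_mem (O : ValuationSubring K) {t : K} {n : ℕ} (hn : n ≠ 0) (h : t ^ n ∈ O) :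
    t ∈ O := by
  rw [← O.valuation_le_one_iff] at h ⊢
  rw [map_pow] at h
  by_contra hlt
  exact (one_lt_pow₀ (lt_of_not_ge hlt) hn).not_ge h

/-- `A₀[t] ⊆ O` as soon as `A₀ ⊆ O` and `t ∈ O`. -/
theorem adjoin_insert_le (O : ValuationSubring K) (A₀ : Subalgebra k K)
    (h₀ : A₀.toSubring ≤ O.toSubring) {t : K} (ht : t ∈ O) :
    (Algebra.adjoin k (insert t (A₀ : Set K))).toSubring ≤ O.toSubring := by
  let Oalg : Subalgebra k K :=
    { O.toSubring with algebraMap_mem' := fun c => h₀ (A₀.algebraMap_mem c) }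
  change Algebra.adjoin k (insert t (A₀ : Set K)) ≤ Oalg
  refine Algebra.adjoin_le ?_
  rintro x (rfl | hx)
  · exact ht
  · exact h₀ hx

/-- `A₀ ≤ A₀[t]`. -/
theorem le_adjoin_insert (A₀ : Subalgebra k K) (t : K) :
    A₀ ≤ Algebra.adjoin k (insert t (A₀ : Set K)) :=
  fun _ hx => Algebra.subset_adjoin (Set.mem_insert_of_mem _ hx)

/-- `t ∈ A₀[t]`. -/
theorem mem_adjoin_insert (A₀ : Subalgebra k K) (t : K) :
    t ∈ Algebra.adjoin k (insert t (A₀ : Set K)) :=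
  Algebra.subset_adjoin (Set.mem_insert _ _)

/-- `A₀[t]` is finitely generated when `A₀` is. -/
theorem fg_adjoin_insert {A₀ : Subalgebra k K} (hfg : A₀.FG) (t : K) :
    (Algebra.adjoin k (insert t (A₀ : Set K))).FG := by
  classical
  obtain ⟨s, rfl⟩ := hfg
  rw [Algebra.adjoin_insert_adjoin, ← Finset.coe_insert]
  exact Subalgebra.fg_adjoin_finset _

/-- `A₀[t] ≤ A` as soon as `A₀ ≤ A` and `t ∈ A`. -/
theorem adjoin_insert_le_of (A₀ A : Subalgebra k K) (t : K) (h : A₀ ≤ A) (ht : t ∈ A) :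
    Algebra.adjoin k (insert t (A₀ : Set K)) ≤ A :=
  Algebra.adjoin_le (Set.insert_subset_iff.mpr ⟨ht, h⟩)

end Helpers

/-! ## §1 Web: the summit implies the crux (S → C) -/

/-- **The summit implies Valuative's `LuAlphaPTorsor`** (all ground fields): resolution in char
`p` ⇒ relative local uniformization (tree, Zariski read backwards), applied to the model
`k[A₀, t]`; neither the regularity of `A₀` at the centre nor the torsor shape is used.
[folklore] -/
theorem luAlphaPTorsor_of_resolutionOfSingularities (hR : _root_.ResolutionOfSingularities) :
    Valuative.LuAlphaPTorsor := by
  intro p hp k K _ _ _ _ O A₀ h₀ t hfg htp hfr _hreg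
  have htO : t ∈ O := mem_of_pow_mem O hp.ne_zero (h₀ htp)
  have hRO := adjoin_insert_le O A₀ h₀ htO
  obtain ⟨A, h, hRA, hAfg, hreg⟩ :=
    (hR p hp).relLocalUniformization k K O _ (fg_adjoin_insert hfg t) hfr hRO
  exact ⟨A, h, (le_adjoin_insert A₀ t).trans hRA, hRA (mem_adjoin_insert A₀ t), hAfg,
    isFractionRing_of_le hRA hfr, hreg⟩

/-- **The summit implies the consequent `TorsorLUPerfect`.** [folklore] -/
theorem torsorLUPerfect_of_resolutionOfSingularities (hR : _root_.ResolutionOfSingularities) :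
    TorsorLUPerfect :=
  torsorLUPerfect_of_luAlphaPTorsor (luAlphaPTorsor_of_resolutionOfSingularities hR)

/-- The consequent alone gives the crux (the two cruxes `FolLU`, `LogCanQuotLU` are discarded):
the glue is WEAKER than the target it feeds. -/
theorem dualSandwich_of_torsorLUPerfect (h : TorsorLUPerfect) : DualSandwich := fun _ _ => h

/-- Valuative's `LuAlphaPTorsor` (stmt-0641) gives the crux. -/
theorem dualSandwich_of_luAlphaPTorsor (h : Valuative.LuAlphaPTorsor) : DualSandwich :=
  dualSandwich_of_torsorLUPerfect (torsorLUPerfect_of_luAlphaPTorsor h)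

/-- **S → C: the summit implies the crux.** [folklore] -/
theorem dualSandwich_of_resolutionOfSingularities (hR : _root_.ResolutionOfSingularities) :
    DualSandwich :=
  dualSandwich_of_torsorLUPerfect (torsorLUPerfect_of_resolutionOfSingularities hR)

/-- **Contrapositive: a refutation of `DualSandwich` refutes resolution of singularities in
positive characteristic.** So the crux is not refutable by any cheap means. [folklore] -/
theorem not_resolutionOfSingularities_of_not_dualSandwich (h : ¬ DualSandwich) :
    ¬ _root_.ResolutionOfSingularities :=
  fun H => h (dualSandwich_of_resolutionOfSingularities H)

/-- A refutation of the crux refutes the route target `TorsorLUPerfect` (stmt-16158, shared with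
ShadowGame / WildCones / FrobeniusClosing). -/
theorem not_torsorLUPerfect_of_not_dualSandwich (h : ¬ DualSandwich) : ¬ TorsorLUPerfect :=
  fun H => h (dualSandwich_of_torsorLUPerfect H)

/-- … and Valuative's `LuAlphaPTorsor` (stmt-0641). -/
theorem not_luAlphaPTorsor_of_not_dualSandwich (h : ¬ DualSandwich) :
    ¬ Valuative.LuAlphaPTorsor :=
  fun H => h (dualSandwich_of_luAlphaPTorsor H)

/-- **What a kill would have to be**: proofs of BOTH open cruxes and a refutation of LU of
`α_p`-torsors over some perfect field. -/
theorem not_dualSandwich_iff : ¬ DualSandwich ↔ (FolLU ∧ LogCanQuotLU ∧ ¬ TorsorLUPerfect) := by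
  rw [dualSandwich_iff, Classical.not_imp, Classical.not_imp]

/-- Modulo its two hypotheses the crux IS the target. -/
theorem dualSandwich_iff_torsorLUPerfect (hF : FolLU) (hQ : LogCanQuotLU) :
    DualSandwich ↔ TorsorLUPerfect :=
  ⟨fun h => h hF hQ, fun h _ _ => h⟩

/-! ## §2 Load-bearing analysis: every hypothesis-mutation lies between the crux and the summit -/

/-- The crux with `FolLU` dropped. -/
def WithoutFolLU : Prop := LogCanQuotLU → TorsorLUPerfect

/-- The crux with `LogCanQuotLU` dropped. -/
def WithoutLogCanQuotLU : Prop := FolLU → TorsorLUPerfect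

/-- The crux with both hypotheses dropped: the bare consequent. -/
def WithoutHypotheses : Prop := TorsorLUPerfect

/-- The crux with perfectness of the ground field dropped from the consequent (the hypotheses
`FolLU`, `LogCanQuotLU` are only stated over perfect fields, so this is the strongest sensible
reading of "drop `[PerfectField k]`"). -/
def WithoutPerfect : Prop := FolLU → LogCanQuotLU → Valuative.LuAlphaPTorsor

theorem dualSandwich_of_withoutFolLU (h : WithoutFolLU) : DualSandwich := fun _ hQ => h hQ

theorem dualSandwich_of_withoutLogCanQuotLU (h : WithoutLogCanQuotLU) : DualSandwich :=
  fun hF _ => h hF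

theorem dualSandwich_of_withoutHypotheses (h : WithoutHypotheses) : DualSandwich := fun _ _ => h

theorem dualSandwich_of_withoutPerfect (h : WithoutPerfect) : DualSandwich :=
  fun hF hQ => torsorLUPerfect_of_luAlphaPTorsor (h hF hQ)

theorem withoutFolLU_of_resolutionOfSingularities (hR : _root_.ResolutionOfSingularities) :
    WithoutFolLU :=
  fun _ => torsorLUPerfect_of_resolutionOfSingularities hR

theorem withoutLogCanQuotLU_of_resolutionOfSingularities (hR : _root_.ResolutionOfSingularities) :
    WithoutLogCanQuotLU :=
  fun _ => torsorLUPerfect_of_resolutionOfSingularities hR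

theorem withoutHypotheses_of_resolutionOfSingularities (hR : _root_.ResolutionOfSingularities) :
    WithoutHypotheses :=
  torsorLUPerfect_of_resolutionOfSingularities hR

theorem withoutPerfect_of_resolutionOfSingularities (hR : _root_.ResolutionOfSingularities) :
    WithoutPerfect :=
  fun _ _ => luAlphaPTorsor_of_resolutionOfSingularities hR

/-- No `dualSandwich_false_without_FolLU` short of `¬ Res`. -/
theorem not_resolutionOfSingularities_of_not_withoutFolLU (h : ¬ WithoutFolLU) :
    ¬ _root_.ResolutionOfSingularities :=
  fun H => h (withoutFolLU_of_resolutionOfSingularities H)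

/-- No `dualSandwich_false_without_LogCanQuotLU` short of `¬ Res`. -/
theorem not_resolutionOfSingularities_of_not_withoutLogCanQuotLU (h : ¬ WithoutLogCanQuotLU) :
    ¬ _root_.ResolutionOfSingularities :=
  fun H => h (withoutLogCanQuotLU_of_resolutionOfSingularities H)

/-- No `dualSandwich_false_without_PerfectField` short of `¬ Res`. -/
theorem not_resolutionOfSingularities_of_not_withoutPerfect (h : ¬ WithoutPerfect) :
    ¬ _root_.ResolutionOfSingularities :=
  fun H => h (withoutPerfect_of_resolutionOfSingularities H)

/-! ## §3 The stubs of line `birth` are summit-implied (verbatim copies of the three predicates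
of `Cruxes/DualSandwich/Lines/birth.lean`, sha 6dc986c0…; that file is not a library module) -/

/-- Verbatim copy of `Lines.Birth.RelStep`. -/
def RelStep (p : ℕ) : Prop :=
  ∀ (k K L : Type) [Field k] [CharP k p] [PerfectField k] [Field K] [Field L] [Algebra k K]
    [Algebra K L] [Algebra k L] [IsScalarTower k K L], IsPurelyInseparable K L →
    (∃ y : L, y ^ p ∈ (algebraMap K L).range ∧ IntermediateField.adjoin K {y} = ⊤) →
    ∀ (O : ValuationSubring L) (B : Subalgebra k L) (hB : B.toSubring ≤ O.toSubring)
      (R : Subalgebra k K), B.FG → IsFractionRing B L →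
      IsRegularLocalRing (Localization.AtPrime
        (Ideal.comap (Subring.inclusion hB) (IsLocalRing.maximalIdeal O))) →
      R.FG → R.map (IsScalarTower.toAlgHom k K L) ≤ B →
      ∃ (A : Subalgebra k K) (hA : A.toSubring ≤ (O.comap (algebraMap K L)).toSubring),
        R ≤ A ∧ A.FG ∧ IsFractionRing A K ∧
        IsRegularLocalRing (Localization.AtPrime
          (Ideal.comap (Subring.inclusion hA)
            (IsLocalRing.maximalIdeal (O.comap (algebraMap K L)))))

/-- Verbatim copy of `Lines.Birth.RelChain`. -/
def RelChain (p : ℕ) : Prop :=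
  ∀ (k K L : Type) [Field k] [CharP k p] [PerfectField k] [Field K] [Field L] [Algebra k K]
    [Algebra K L] [Algebra k L] [IsScalarTower k K L] [FiniteDimensional K L]
    [IsPurelyInseparable K L] (O : ValuationSubring L) (B : Subalgebra k L)
    (hB : B.toSubring ≤ O.toSubring) (R : Subalgebra k K), B.FG → IsFractionRing B L →
    IsRegularLocalRing (Localization.AtPrime
      (Ideal.comap (Subring.inclusion hB) (IsLocalRing.maximalIdeal O))) →
    R.FG → R.map (IsScalarTower.toAlgHom k K L) ≤ B →
    ∃ (A : Subalgebra k K) (hA : A.toSubring ≤ (O.comap (algebraMap K L)).toSubring),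
      R ≤ A ∧ A.FG ∧ IsFractionRing A K ∧
      IsRegularLocalRing (Localization.AtPrime
        (Ideal.comap (Subring.inclusion hA)
          (IsLocalRing.maximalIdeal (O.comap (algebraMap K L)))))

/-- Verbatim copy of `Lines.Birth.FrobeniusTop`. -/
def FrobeniusTop : Prop :=
  ∀ p : ℕ, p.Prime → ∀ (k K : Type) [Field k] [CharP k p] [PerfectField k] [Field K]
    [Algebra k K] (O : ValuationSubring K) (A₀ : Subalgebra k K)
    (h₀ : A₀.toSubring ≤ O.toSubring) (t : K), A₀.FG → t ^ p ∈ A₀ →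
    IsFractionRing (Algebra.adjoin k (insert t (A₀ : Set K))) K →
    IsRegularLocalRing (Localization.AtPrime
      (Ideal.comap (Subring.inclusion h₀) (IsLocalRing.maximalIdeal O))) →
    ∃ (L : Type) (_ : Field L) (_ : Algebra k L) (_ : Algebra K L) (_ : IsScalarTower k K L)
      (_ : FiniteDimensional K L) (_ : IsPurelyInseparable K L) (O' : ValuationSubring L)
      (B : Subalgebra k L) (hB : B.toSubring ≤ O'.toSubring) (R : Subalgebra k K),
      O'.comap (algebraMap K L) = O ∧ B.FG ∧ IsFractionRing B L ∧
      IsRegularLocalRing (Localization.AtPrime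
        (Ideal.comap (Subring.inclusion hB) (IsLocalRing.maximalIdeal O'))) ∧
      A₀ ≤ R ∧ t ∈ R ∧ R.FG ∧ R.map (IsScalarTower.toAlgHom k K L) ≤ B

/-- **`FrobeniusTop` is implied by the consequent `TorsorLUPerfect`** (trivial top `L := K`,
`O' := O`, `B :=` the uniformizing model `A ⊇ k[A₀, t]`, `R := k[A₀, t]`). So the stub cannot be
false unless LU of `α_p`-torsors over a perfect field fails; its mathematical content is that the
INTENDED witness (`L = K₀^{1/p}`, `B = A₀^{1/p}`) is available without knowing LU. -/
theorem frobeniusTop_of_torsorLUPerfect (h : TorsorLUPerfect) : FrobeniusTop := by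
  intro p hp k K _ _ _ _ _ O A₀ h₀ t hfg htp hfr hreg
  obtain ⟨A, hA, hA₀A, htA, hAfg, hAfr, hAreg⟩ := h p hp k K O A₀ h₀ t hfg htp hfr hreg
  refine ⟨K, inferInstance, inferInstance, inferInstance, inferInstance, inferInstance,
    inferInstance, O, A, hA, Algebra.adjoin k (insert t (A₀ : Set K)), ?_, hAfg, hAfr, hAreg,
    le_adjoin_insert A₀ t, mem_adjoin_insert A₀ t, fg_adjoin_insert hfg t, ?_⟩
  · ext x
    simp [ValuationSubring.mem_comap]
  · rw [Subalgebra.map_le]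
    intro x hx
    simpa using adjoin_insert_le_of A₀ A t hA₀A htA hx

/-- Hence `FrobeniusTop` follows from the summit. -/
theorem frobeniusTop_of_resolutionOfSingularities (hR : _root_.ResolutionOfSingularities) :
    FrobeniusTop :=
  frobeniusTop_of_torsorLUPerfect (torsorLUPerfect_of_resolutionOfSingularities hR)

/-- No `frobeniusTop_false` short of `¬ Res`. -/
theorem not_resolutionOfSingularities_of_not_frobeniusTop (h : ¬ FrobeniusTop) :
    ¬ _root_.ResolutionOfSingularities :=
  fun H => h (frobeniusTop_of_resolutionOfSingularities H)

/-- `RelChain p → RelStep p`: a height-one simple extension `L = K(y)`, `y ^ p ∈ K`, purely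
inseparable, is finite-dimensional, so the one-step statement is a special case of the chain
statement (the converse is the stub `stub_relChain`, an induction on `[L : K]`). -/
theorem relStep_of_relChain {p : ℕ} (hp : p.Prime) (h : RelChain p) : RelStep p := by
  intro k K L _ _ _ _ _ _ _ _ _ hPI hy O B hB R hBfg hBfr hBreg hRfg hRB
  obtain ⟨y, ⟨c, hc⟩, hKy⟩ := hy
  haveI : FiniteDimensional K L := by
    have hint : IsIntegral K y := by
      refine ⟨Polynomial.X ^ p - Polynomial.C c, ?_, ?_⟩
      · exact Polynomial.monic_X_pow_sub_C c hp.ne_zero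
      · simp [hc]
    have hfd : FiniteDimensional K (IntermediateField.adjoin K {y}) :=
      IntermediateField.adjoin.finiteDimensional hint
    rw [hKy] at hfd
    exact IntermediateField.topEquiv.toLinearEquiv.finiteDimensional
  exact h k K L O B hB R hBfg hBfr hBreg hRfg hRB

/-! ### §3b `RelChain` / `RelStep` are summit-implied: they are relative LU for `O ∩ K`, and
`K/k` is finitely generated because `K ⊆ L = Frac B` with `[L : K] < ∞` -/

/-- `1 ≤ ringExpChar R`. -/
theorem one_le_ringExpChar (R : Type) [NonAssocSemiring R] : 1 ≤ ringExpChar R :=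
  le_max_right _ _

/-- **Finite generation descends along a finite purely inseparable extension**: if `L/k` is
finitely generated as a field and `L/K` is finite purely inseparable, then `K/k` is finitely
generated as a field (`q = (exp. char.)^(exponent)` kills `L` into `K`; `K' = k(z_i^q)` for
generators `z_i` of `L/k` is finitely generated, `L/K'` is finite, hence so is `K/K'`).
[folklore] -/
theorem fg_top_of_fg_top_of_isPurelyInseparable {k K L : Type} [Field k] [Field K] [Field L]
    [Algebra k K] [Algebra K L] [Algebra k L] [IsScalarTower k K L] [FiniteDimensional K L]
    [IsPurelyInseparable K L] (hL : (⊤ : IntermediateField k L).FG) :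
    (⊤ : IntermediateField k K).FG := by
  classical
  obtain ⟨s, hs⟩ := hL
  set q : ℕ := ringExpChar K ^ IsPurelyInseparable.exponent K L with hq
  have hq0 : q ≠ 0 := pow_ne_zero _ (Nat.one_le_iff_ne_zero.mp (one_le_ringExpChar K))
  have hmem : ∀ z : L, ∃ c : K, algebraMap K L c = z ^ q := fun z =>
    IsPurelyInseparable.exponent_def K z
  choose c hc using hmem
  set K' : IntermediateField k K := IntermediateField.adjoin k ((s.image c : Finset K) : Set K)
    with hK'
  have hK'fg : (⊤ : IntermediateField k K').FG :=
    IntermediateField.fg_top_iff.mpr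
      (IntermediateField.essFiniteType_iff.mpr ⟨s.image c, rfl⟩)
  have hint : ∀ z ∈ (s : Set L), IsIntegral K' z := by
    intro z hz
    have hcz : c z ∈ K' := IntermediateField.subset_adjoin k _
      (by exact_mod_cast Finset.mem_image_of_mem c hz)
    refine ⟨Polynomial.X ^ q - Polynomial.C ⟨c z, hcz⟩, Polynomial.monic_X_pow_sub_C _ hq0, ?_⟩
    have : algebraMap K' L ⟨c z, hcz⟩ = z ^ q := hc z
    simp [this]
  haveI : FiniteDimensional K' L := by
    have htop : IntermediateField.adjoin K' (s : Set L) = ⊤ := by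
      apply top_le_iff.mp
      intro x _
      have hx : x ∈ IntermediateField.adjoin k (s : Set L) := by rw [hs]; trivial
      have hle : IntermediateField.adjoin k (s : Set L) ≤
          (IntermediateField.adjoin K' (s : Set L)).restrictScalars k :=
        IntermediateField.adjoin_le_iff.mpr (IntermediateField.subset_adjoin K' _)
      exact hle hx
    have hfd : FiniteDimensional K' (IntermediateField.adjoin K' (s : Set L)) :=
      IntermediateField.finiteDimensional_adjoin hint
    rw [htop] at hfd
    exact IntermediateField.topEquiv.toLinearEquiv.finiteDimensional
  haveI : FiniteDimensional K' K :=
    FiniteDimensional.of_injective (IsScalarTower.toAlgHom K' K L).toLinearMap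
      (algebraMap K L).injective
  haveI : Algebra.EssFiniteType k K' := IntermediateField.fg_top_iff.mp hK'fg
  haveI : Algebra.EssFiniteType K' K := inferInstance
  exact IntermediateField.fg_top_iff.mpr (Algebra.EssFiniteType.comp k K' K)

/-- The fraction field of a finitely generated subalgebra is a finitely generated field.
[folklore] -/
theorem fg_top_of_isFractionRing_subalgebra {k L : Type} [Field k] [Field L] [Algebra k L]
    (B : Subalgebra k L) (hBfg : B.FG) (hBfr : IsFractionRing B L) :
    (⊤ : IntermediateField k L).FG := by
  haveI : Algebra.FiniteType k B := B.fg_iff_finiteType.mp hBfg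
  haveI : Algebra.EssFiniteType B L := Algebra.EssFiniteType.of_isLocalization L (nonZeroDivisors B)
  exact IntermediateField.fg_top_iff.mpr (Algebra.EssFiniteType.comp k B L)

/-- **`RelChain p` follows from resolution in characteristic `p`** (for prime `p`): it is
relative local uniformization of `O ∩ K ∋ R` for the finitely generated field `K/k`
(`fg_top_of_fg_top_of_isPurelyInseparable`), which the summit gives through
`lurel_of_resolutionInChar`; the regular top `B` is used only to know that `L`, hence `K`, is
finitely generated and that `k ⊆ O`. So `stub_relChain` cannot be false short of `¬ Res_p`.
[folklore] -/
theorem relChain_of_resolutionInChar {p : ℕ} (hp : p.Prime) (hR : ResolutionInChar.{0} p) :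
    RelChain p := by
  intro k K L _ _ _ _ _ _ _ _ _ _ _ O B hB R hBfg hBfr _hBreg hRfg hRB
  have hLfg : (⊤ : IntermediateField k L).FG := fg_top_of_isFractionRing_subalgebra B hBfg hBfr
  have hKfg : (⊤ : IntermediateField k K).FG := fg_top_of_fg_top_of_isPurelyInseparable hLfg
  have hO : ∀ c : k, algebraMap k K c ∈ O.comap (algebraMap K L) := by
    intro c
    rw [ValuationSubring.mem_comap, ← IsScalarTower.algebraMap_apply]
    exact hB (B.algebraMap_mem c)
  have hRO : R.toSubring ≤ (O.comap (algebraMap K L)).toSubring := by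
    intro x hx
    change x ∈ O.comap (algebraMap K L)
    rw [ValuationSubring.mem_comap]
    exact hB (hRB (Subalgebra.mem_map.mpr ⟨x, hx, rfl⟩))
  obtain ⟨A, hA, hRA, hAfg, hAfr, hreg⟩ :=
    Literature.AlgebraicGeometry.Resolution.lurel_of_resolutionInChar p hp hR k K hKfg
      (O.comap (algebraMap K L)) hO R hRfg hRO
  exact ⟨A, hA, hRA, hAfg, hAfr, hreg⟩

/-- Hence `RelChain p` for every prime `p` from the summit … -/
theorem relChain_of_resolutionOfSingularities (hR : _root_.ResolutionOfSingularities) {p : ℕ}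
    (hp : p.Prime) : RelChain p :=
  relChain_of_resolutionInChar hp (hR p hp)

/-- … and `RelStep p`. -/
theorem relStep_of_resolutionOfSingularities (hR : _root_.ResolutionOfSingularities) {p : ℕ}
    (hp : p.Prime) : RelStep p :=
  relStep_of_relChain hp (relChain_of_resolutionOfSingularities hR hp)

/-- No `stub_relChain_false` at a prime short of `¬ Res`. -/
theorem not_resolutionOfSingularities_of_not_relChain {p : ℕ} (hp : p.Prime) (h : ¬ RelChain p) :
    ¬ _root_.ResolutionOfSingularities :=
  fun H => h (relChain_of_resolutionOfSingularities H hp)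

/-- No `stub_relStep_false` at a prime short of `¬ Res` (besides: `stub_relStep` is PROVED from
`FolLU ∧ LogCanQuotLU`, `StubRelStepProof.lean`). -/
theorem not_resolutionOfSingularities_of_not_relStep {p : ℕ} (hp : p.Prime) (h : ¬ RelStep p) :
    ¬ _root_.ResolutionOfSingularities :=
  fun H => h (relStep_of_resolutionOfSingularities H hp)

/-- **All three stub statements of line `birth` follow from the summit** (so the line can only
fail on formalization cost, never on a counterexample). -/
theorem stubs_of_resolutionOfSingularities (hR : _root_.ResolutionOfSingularities) :
    (FolLU → LogCanQuotLU → ∀ p : ℕ, p.Prime → RelStep p) ∧ FrobeniusTop ∧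
      (∀ p : ℕ, p.Prime → RelStep p → RelChain p) :=
  ⟨fun _ _ _ hp => relStep_of_resolutionOfSingularities hR hp,
    frobeniusTop_of_resolutionOfSingularities hR,
    fun _ hp _ => relChain_of_resolutionOfSingularities hR hp⟩

/-! ## §4 Degenerate instance exercised: the trivial valuation `O = K` needs no blow-up
(the model `k[A₀, t]` already has the four non-regularity conjuncts of the consequent). -/

example {k K : Type} [Field k] [Field K] [Algebra k K] (A₀ : Subalgebra k K) (t : K)
    (hfg : A₀.FG) (hfr : IsFractionRing (Algebra.adjoin k (insert t (A₀ : Set K))) K) :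
    ∃ A : Subalgebra k K, A₀ ≤ A ∧ t ∈ A ∧ A.FG ∧ IsFractionRing A K :=
  ⟨_, le_adjoin_insert A₀ t, mem_adjoin_insert A₀ t, fg_adjoin_insert hfg t, hfr⟩


/-! ## §5 (gen 2) The one genuine falsity near the crux: NAIVE DESCENT; and vacuous closures -/

/-- **Naive descent is FALSE** (re-export of the landed
`Theorems.naiveDescent_false`, `Theorems/DualSandwich/Negative/NaiveDescent.lean`): it is NOT
true that for `k` perfect of characteristic `p`, `F ⊆ L` with `L ^ p ⊆ F` and `L = F(y)`, `O` a
valuation ring of `L`, `B ⊆ O` finitely generated with `Frac B = L` and regular at the centre,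
the trace `C = B ∩ F` is regular at the centre of `O`. Witness `𝔽₂[X₀,X₁] ∩ 𝔽₂(X₀²,X₀X₁) =
𝔽₂[X₀²,X₀X₁,X₁²]` (the `A₁` point) along the order valuation at the origin. So every
degree-`p` descent of the sandwich consumes a modification of the bottom model. [folklore] -/
theorem naiveDescent_false : ¬ (∀ p : ℕ, p.Prime → ∀ (k L : Type) [Field k] [CharP k p]
    [PerfectField k] [Field L] [Algebra k L] (F : IntermediateField k L),
    (∀ x : L, x ^ p ∈ F) → (∃ y : L, ∀ x : L, x ∈ IntermediateField.adjoin F {y}) →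
    ∀ (O : ValuationSubring L) (B : Subalgebra k L) (hB : B.toSubring ≤ O.toSubring),
    B.FG → IsFractionRing B L →
    IsRegularLocalRing (Localization.AtPrime (Ideal.comap (Subring.inclusion hB)
      (IsLocalRing.maximalIdeal O))) →
    ∀ (C : Subalgebra k L) (hC : C.toSubring ≤ O.toSubring), (∀ x : L, x ∈ C ↔ x ∈ B ∧ x ∈ F) →
    IsRegularLocalRing (Localization.AtPrime (Ideal.comap (Subring.inclusion hC)
      (IsLocalRing.maximalIdeal O)))) :=
  Summit.ResolutionOfSingularities.ResolutionOfSingularities.Theorems.naiveDescent_false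

/-- The crux closes VACUOUSLY if `FolLU` (stmt-17081) is refuted. -/
theorem dualSandwich_of_not_folLU (h : ¬ FolLU) : DualSandwich := fun hF => absurd hF h

/-- The crux closes VACUOUSLY if `LogCanQuotLU` (stmt-17082) is refuted. -/
theorem dualSandwich_of_not_logCanQuotLU (h : ¬ LogCanQuotLU) : DualSandwich :=
  fun _ hQ => absurd hQ h

/-- Curried/uncurried: the crux is `FolLU ∧ LogCanQuotLU → TorsorLUPerfect`. -/
theorem dualSandwich_iff_and : DualSandwich ↔ (FolLU ∧ LogCanQuotLU → TorsorLUPerfect) :=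
  ⟨fun h hFQ => h hFQ.1 hFQ.2, fun h hF hQ => h ⟨hF, hQ⟩⟩

/-- Decision table of the crux in terms of its three constituents (all four cases):
it is FALSE exactly in the case `FolLU ∧ LogCanQuotLU ∧ ¬ TorsorLUPerfect`. -/
theorem dualSandwich_iff_not_and : DualSandwich ↔ ¬ (FolLU ∧ LogCanQuotLU ∧ ¬ TorsorLUPerfect) := by
  rw [← not_dualSandwich_iff, not_not]

end Summit.ResolutionOfSingularities.ResolutionOfSingularities.Cruxes.DualSandwich.Disproof

end
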